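import Summits.ValiantsHypothesis.ValiantsHypothesis.Theorems.BarrierLeverPartitionMinorsSubsetSumFrobenius
import Summits.ValiantsHypothesis.ValiantsHypothesis.Theorems.BarrierLeverPartitionMinorsSubsetSumGenericNonsingular

/-!
# Route BarrierLever — item `PartitionMinorsHitByVP` (stmt-ValiantsHypothesis-19717):
# `SubsetSum.GenericNonsingular h κ` holds for every `h, κ`

Helper file (`--supports stmt-ValiantsHypothesis-19717`; cell valiant-natproofs, rung V4, 𝒟-side door (c),
prover seat val-np-p1, gen 10). Closes NO item; definition-free bridge between the Theorems-side predicate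
`SubsetSum.GenericNonsingular h κ` (val-np-p3 g5, file `…SubsetSumGenericNonsingular`: «the symbolic subset-sum
Vandermonde `ssv κ u` is nonsingular for every injective row family `u`», typed as the conditional of record for
the class «all `2^κ` rows × `κ`-face columns») and ENGINE v3 `SubsetSum.det_ssv_ne_zero_of_injective`
(file `…SubsetSumFrobenius`, this seat: reduction mod 2, Frobenius table, Vandermonde of code polynomials).

* `genericNonsingular_all (h κ) : GenericNonsingular h κ` — unconditionally, all `h, κ`; hence p3 g5's
  conditionals `partitionMinor_hit_face_of_genericNonsingular[_fin]`, `partitionMinor_hit_of_face_genericNonsingular`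
  apply with this proof term (the resulting statements are the theorems of `…AllRowsFaces`, not restated here).

WHAT THIS IS NOT: nothing beyond faces here (see `…BinaryContiguous` / `…PrimaryContiguous` for the wider
column classes); item 19717 stays open; nothing on crux 14610 or VP vs VNP.
-/

set_option linter.dupNamespace false

namespace Summit.ValiantsHypothesis.ValiantsHypothesis.Theorems.BarrierLever.SubsetSum

/-- **`GenericNonsingular h κ` holds for all `h, κ`** (engine v3). -/
theorem genericNonsingular_all (h κ : ℕ) : GenericNonsingular h κ :=
  fun u hu => det_ssv_ne_zero_of_injective κ u hu

end Summit.ValiantsHypothesis.ValiantsHypothesis.Theorems.BarrierLever.SubsetSum
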